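import Literature.Geometry.Kaehler.ComplexTorusAnalyticIteratedIntersectionNonvanishing
import Literature.Geometry.Kaehler.ComplexTorusAnalyticCycleDegreeComponents
import HarnessLib

/-!
# The intersection numbers `(L^r · Y · D₀ ⋯ D_{k−1})` of a polarised complex torus are non-negative INTEGERS,
# positive iff every iterated translate `⋂_j (D_j − τ_j)` meets `Y`

Layer `Literature/Geometry/Kaehler`; lane `lit-hodgefound`, seat p07, programme «INTERSECTION NUMBERS ARE
POINT COUNTS», file 16. Let `X = E/Λ` be a compact complex torus with a polarisation `L` (`η` a Riemann form,
`c₁(L) = ofRealForm(−η)`), `Y ⊆ X` closed analytic of pure dimension `d = r + k`, `D₀, …, D_{k−1}` closed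
analytic hypersurfaces, and

  `(L^r · Y · D₀ ⋯ D_{k−1}) = ⟨c₁(L)^{∧r}, sign(e)^k · [Y]_e ∧ [D₀]_e ∧ ⋯ ∧ [D_{k−1}]_e⟩_e`.

By file 10 (Fulton Thm. 12.2 (a)) the intersection class is `cl(R)` for an EFFECTIVE analytic `r`-cycle
`R = Σ m_W [W]`, and `(L^r · W) = ∫_W c₁(L)^{∧r}` is a POSITIVE INTEGER for every `r`-dimensional closed
analytic `W` ([deJong1993AmpleLineBundles, VII Remarks 4.3 (a) and Thm. 4.3.1]; tree:
`IsRiemannForm.exists_pos_analyticCyclePeriod_wedgeFamily_eq`). Hence `(L^r · Y · D₀ ⋯ D_{k−1}) = Σ m_W (L^r · W)`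
is a non-negative integer, zero iff `R = 0` iff the intersection class vanishes iff SOME iterated translate
`⋂_j (D_j − τ_j)` misses `Y` (file 15), and otherwise `≥ 1` and `≥ #components` of every proper `Z(τ)`
(file 9, now without the integrality hypothesis).

> [Fulton1998, §12.2 Thm. 12.2 (a)]: the intersection class on a variety with generated tangent bundle is
> represented by a non-negative cycle; [Fulton1998, §12.2 Example 12.2.1 (a), §8.4 Example 8.4.6];
> [deJong1993AmpleLineBundles, Ch. VII §4 Remarks 4.3 (a), (c) and Thm. 4.3.1]: `deg_L` of a closed
> subvariety is a positive integer; [Lange2023AbelianVarietiesComplex, §4.6.2 p. 235]: intersection numbers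
> of analytic cycles on a complex torus.

Contents (theorems only; no definitions, no named facts):

* §1 **`IsRiemannForm.exists_nat_poincarePairing_wedgePow_smul_wedge_wedgeFamily_eq`** — `(L^r · Y · D₀ ⋯ D_{k−1}) ∈ ℕ`;
  `IsRiemannForm.poincarePairing_wedgePow_smul_wedge_wedgeFamily_eq_zero_iff` (`= 0` iff
  `[Y] ∧ [D₀] ∧ ⋯ ∧ [D_{k−1}] = 0`);
* §2 **`IsRiemannForm.poincarePairing_wedgePow_smul_wedge_wedgeFamily_eq_zero_iff_exists_inter_iInter_translate_eq_empty`**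
  (`= 0` iff some `Y ∩ ⋂_j (D_j − τ_j) = ∅`),
  `IsRiemannForm.one_le_re_poincarePairing_wedgePow_smul_wedge_wedgeFamily_iff` (`≥ 1` iff all translates meet `Y`);
* §3 `IsRiemannForm.exists_nat_poincarePairing_eq_and_forall_ncard_isIrreducibleComponent_le` — Bézout of
  file 9 with the integer `m = (L^r · Y · D₀ ⋯ D_{k−1})`: every proper `Z(τ)` has at most `m` components.

## References

* [Fulton1998] W. Fulton, *Intersection Theory*, 2nd ed., Springer 1998, §8.4 Example 8.4.6, §12.2
  Thm. 12.2 (a), Example 12.2.1 (a).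
* [deJong1993AmpleLineBundles] J. de Jong (ed.), *Ample line bundles and intersection theory*, Ch. VII §4
  Remarks 4.3 (a), (c), (e) and Thm. 4.3.1.
* [Lange2023AbelianVarietiesComplex] H. Lange, *Abelian Varieties over the Complex Numbers*, Springer 2023,
  §4.6.2 Lemma 4.6.4 and p. 235.
-/

noncomputable section

open scoped Manifold Topology Pointwise
open MeasureTheory Set Function Filter Module
open Literature.LinearAlgebra.Alternating

namespace Literature.Geometry.Kaehler
namespace ComplexTorus

universe u

variable {ι : Type*} [Fintype ι] [DecidableEq ι] {E : Type u} [NormedAddCommGroup E] [InnerProductSpace ℂ E]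
  [FiniteDimensional ℂ E] [MeasurableSpace E] [BorelSpace E] (Φ : (ι → ℝ) ≃L[ℝ] E) {n : ℕ} (e : Fin n ≃ ι)

/-! ### §0 The `L`-degree of an effective cycle is a non-negative integer, positive unless the cycle is `0` -/

/-- **`deg_L T = Σ_W m_W (L^r · W) ∈ ℕ` for an effective analytic `r`-cycle `T`**, and `deg_L T > 0` if `T ≠ 0`
(each `(L^r · W)` is a positive integer). [cite: deJong1993AmpleLineBundles, Ch. VII §4 Remarks 4.3 (a), (c) and Thm. 4.3.1]
[cite: Fulton1998, §12.2 Example 12.2.1 (a)] -/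
theorem IsRiemannForm.exists_nat_poincarePairing_wedgePow_chainCycleClass_eq {r k' : ℕ} (h : 2 * r + k' = n)
    {T : HolomorphicChain 𝓘(ℂ, E) (ComplexTorus Φ) r} (hT0 : ∀ W, 0 ≤ T.mult W)
    {η : E [⋀^Fin 2]→L[ℝ] ℝ} (hη : IsRiemannForm Φ η) :
    ∃ m : ℕ, poincarePairing Φ e h (wedgePow (ofRealForm (-η)) r) (chainCycleClass Φ e h T) = m ∧
      (T ≠ 0 → 0 < m) := by
  classical
  -- the `L`-degree of every component is a positive integer
  have hcomp : ∀ W ∈ T.finite_components_of_compactSpace.toFinset, ∃ mW : ℕ, 0 < mW ∧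
      poincarePairing Φ e h (wedgePow (ofRealForm (-η)) r) (setCycleClass Φ e h W) = mW := by
    intro W hW
    have hW0 : T.mult W ≠ 0 := T.finite_components_of_compactSpace.mem_toFinset.1 hW
    have hWd := T.hasPureDim_of_mult_ne_zero hW0
    obtain ⟨mW, hpos, hmW⟩ := IsRiemannForm.exists_pos_analyticCyclePeriod_wedgeFamily_eq Φ hWd fun _ : Fin r ↦ hη
    refine ⟨mW, hpos, ?_⟩
    rw [poincarePairing_setCycleClass Φ e h hWd]
    exact hmW
  choose! m hmpos hm using hcomp
  refine ⟨∑ W ∈ T.finite_components_of_compactSpace.toFinset, (T.mult W).toNat * m W, ?_, ?_⟩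
  · rw [chainCycleClass, map_sum, Nat.cast_sum]
    refine Finset.sum_congr rfl fun W hW ↦ ?_
    have hcast : (((T.mult W).toNat : ℕ) : ℂ) = ((T.mult W : ℤ) : ℂ) := by
      have := Int.toNat_of_nonneg (hT0 W)
      exact_mod_cast this
    rw [map_zsmul, hm W hW, zsmul_eq_mul, Nat.cast_mul, hcast]
  · intro hT
    have hne : T.finite_components_of_compactSpace.toFinset.Nonempty := by
      rw [Finset.nonempty_iff_ne_empty]
      exact fun h0 ↦ hT ((HolomorphicChain.eq_zero_iff_toFinset_eq_empty T).2 h0)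
    obtain ⟨W, hW⟩ := hne
    have hW0 : T.mult W ≠ 0 := T.finite_components_of_compactSpace.mem_toFinset.1 hW
    have h1 : 1 ≤ (T.mult W).toNat := by
      have : 0 < T.mult W := lt_of_le_of_ne (hT0 W) (Ne.symm hW0)
      omega
    exact Finset.sum_pos' (fun _ _ ↦ Nat.zero_le _) ⟨W, hW, Nat.mul_pos (by omega) (hmpos W hW)⟩

/-! ### §1 `(L^r · Y · D₀ ⋯ D_{k−1})` is a non-negative integer -/

/-- **`(L^r · Y · D₀ ⋯ D_{k−1}) ∈ ℕ`.** For a Riemann form `η` (`c₁(L) = ofRealForm(−η)`), `Y` closed analytic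
of pure dimension `r + k` and closed analytic hypersurfaces `D_j`, the pairing
`⟨c₁(L)^{∧r}, sign(e)^k · [Y]_e ∧ [D₀]_e ∧ ⋯ ∧ [D_{k−1}]_e⟩_e` is a natural number: the intersection class is the
class of an effective `r`-cycle `R` (file 10, Fulton Thm. 12.2 (a)) and `deg_L R ∈ ℕ`.
[cite: Fulton1998, §12.2 Thm. 12.2 (a) and Example 12.2.1 (a)] [cite: deJong1993AmpleLineBundles, Ch. VII §4 Thm. 4.3.1]
[cite: Lange2023AbelianVarietiesComplex, §4.6.2 p. 235] -/
theorem IsRiemannForm.exists_nat_poincarePairing_wedgePow_smul_wedge_wedgeFamily_eq {q : ℕ}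
    (hq : 2 * q + 2 * 1 = n) (k : ℕ) {d p p' r : ℕ} (hk : 2 * d + 2 * p = n) (hp' : p + k = p') (hr : r + k = d)
    {Y : Set (ComplexTorus Φ)} (hY : HasPureDim 𝓘(ℂ, E) Y d)
    {D : Fin k → Set (ComplexTorus Φ)} (hD : ∀ j, HasPureDim 𝓘(ℂ, E) (D j) q)
    {η : E [⋀^Fin 2]→L[ℝ] ℝ} (hη : IsRiemannForm Φ η) :
    ∃ m : ℕ, poincarePairing Φ e (by omega : 2 * r + 2 * p' = n) (wedgePow (ofRealForm (-η)) r)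
        ((orientationSign Φ e : ℂ) ^ k •
          ((analyticCycleClass Φ e hk hY).wedge
              (wedgeFamily k fun j ↦ analyticCycleClass Φ e hq (hD j))).domDomCongr
            (finCongr (by omega : 2 * p + 2 * k = 2 * p'))) = m := by
  obtain ⟨R, hR0, -, hRcl⟩ :=
    exists_effectiveCycle_smul_wedge_wedgeFamily_eq_chainCycleClass_support_subset Φ e hq k hk hp' hr hY hD 0
  obtain ⟨m, hm, -⟩ := hη.exists_nat_poincarePairing_wedgePow_chainCycleClass_eq Φ e
    (by omega : 2 * r + 2 * p' = n) hR0
  exact ⟨m, by rw [hRcl]; exact hm⟩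

/-- **`(L^r · Y · D₀ ⋯ D_{k−1}) = 0` iff `[Y] ∧ [D₀] ∧ ⋯ ∧ [D_{k−1}] = 0`**: the degree of a non-zero effective cycle
is positive. [cite: Fulton1998, §12.2 Thm. 12.2 (a) and Example 12.2.1 (a)] [cite: deJong1993AmpleLineBundles, Ch. VII §4 Thm. 4.3.1] -/
theorem IsRiemannForm.poincarePairing_wedgePow_smul_wedge_wedgeFamily_eq_zero_iff {q : ℕ}
    (hq : 2 * q + 2 * 1 = n) (k : ℕ) {d p p' r : ℕ} (hk : 2 * d + 2 * p = n) (hp' : p + k = p') (hr : r + k = d)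
    {Y : Set (ComplexTorus Φ)} (hY : HasPureDim 𝓘(ℂ, E) Y d)
    {D : Fin k → Set (ComplexTorus Φ)} (hD : ∀ j, HasPureDim 𝓘(ℂ, E) (D j) q)
    {η : E [⋀^Fin 2]→L[ℝ] ℝ} (hη : IsRiemannForm Φ η) :
    poincarePairing Φ e (by omega : 2 * r + 2 * p' = n) (wedgePow (ofRealForm (-η)) r)
        ((orientationSign Φ e : ℂ) ^ k •
          ((analyticCycleClass Φ e hk hY).wedge
              (wedgeFamily k fun j ↦ analyticCycleClass Φ e hq (hD j))).domDomCongr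
            (finCongr (by omega : 2 * p + 2 * k = 2 * p'))) = 0 ↔
      (analyticCycleClass Φ e hk hY).wedge (wedgeFamily k fun j ↦ analyticCycleClass Φ e hq (hD j)) = 0 := by
  have h2 : 2 * r + 2 * p' = n := by omega
  have hc : 2 * p + 2 * k = 2 * p' := by omega
  constructor
  · intro h0
    obtain ⟨R, hR0, -, hRcl⟩ :=
      exists_effectiveCycle_smul_wedge_wedgeFamily_eq_chainCycleClass_support_subset Φ e hq k hk hp' hr hY hD 0
    obtain ⟨m, hm, hmpos⟩ := hη.exists_nat_poincarePairing_wedgePow_chainCycleClass_eq Φ e h2 hR0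
    -- `m = 0`, hence `R = 0`
    have hRcl' : (orientationSign Φ e : ℂ) ^ k •
        ((analyticCycleClass Φ e hk hY).wedge
            (wedgeFamily k fun j ↦ analyticCycleClass Φ e hq (hD j))).domDomCongr (finCongr hc) =
        chainCycleClass Φ e h2 R := hRcl
    have h0' : poincarePairing Φ e h2 (wedgePow (ofRealForm (-η)) r) (chainCycleClass Φ e h2 R) = 0 := by
      rw [← hRcl']; exact h0
    have hm0 : m = 0 := by
      rw [hm] at h0'
      exact_mod_cast h0'
    have hR : R = 0 := by
      by_contra hR
      exact (lt_irrefl 0) (hm0 ▸ hmpos hR)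
    rw [hR, chainCycleClass_zero, smul_eq_zero] at hRcl'
    rcases hRcl' with hs | hw
    · exact absurd hs (pow_ne_zero _ (orientationSign_ne_zero Φ e))
    · have h' := congrArg (fun ω ↦ ω.domDomCongr (finCongr hc.symm)) hw
      simpa only [domDomCongr_finCongr_trans, domDomCongr_finCongr_self, domDomCongr_finCongr_zero] using h'
  · intro hw
    rw [hw, domDomCongr_finCongr_zero, smul_zero, map_zero]

/-! ### §2 `(L^r · Y · D₀ ⋯ D_{k−1}) > 0` iff every iterated translate meets `Y` -/

/-- **`(L^r · Y · D₀ ⋯ D_{k−1}) = 0` iff SOME iterated translate `⋂_j (D_j − τ_j)` misses `Y`** (file 15 §1).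
[cite: Fulton1998, §12.2 (a) and Example 11.4.5] [cite: Lange2023AbelianVarietiesComplex, §4.6.2 Lemma 4.6.4 and Lemma 4.6.5] -/
theorem IsRiemannForm.poincarePairing_wedgePow_smul_wedge_wedgeFamily_eq_zero_iff_exists_inter_iInter_translate_eq_empty
    {q : ℕ} (hq : 2 * q + 2 * 1 = n) (k : ℕ) {d p p' r : ℕ} (hk : 2 * d + 2 * p = n) (hp' : p + k = p')
    (hr : r + k = d) {Y : Set (ComplexTorus Φ)} (hY : HasPureDim 𝓘(ℂ, E) Y d)
    {D : Fin k → Set (ComplexTorus Φ)} (hD : ∀ j, HasPureDim 𝓘(ℂ, E) (D j) q)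
    {η : E [⋀^Fin 2]→L[ℝ] ℝ} (hη : IsRiemannForm Φ η) :
    poincarePairing Φ e (by omega : 2 * r + 2 * p' = n) (wedgePow (ofRealForm (-η)) r)
        ((orientationSign Φ e : ℂ) ^ k •
          ((analyticCycleClass Φ e hk hY).wedge
              (wedgeFamily k fun j ↦ analyticCycleClass Φ e hq (hD j))).domDomCongr
            (finCongr (by omega : 2 * p + 2 * k = 2 * p'))) = 0 ↔
      ∃ τ : Fin k → ComplexTorus Φ, Y ∩ ⋂ j, (fun x ↦ x + τ j) ⁻¹' D j = ∅ := by
  rw [hη.poincarePairing_wedgePow_smul_wedge_wedgeFamily_eq_zero_iff Φ e hq k hk hp' hr hY hD]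
  exact wedge_wedgeFamily_eq_zero_iff_exists_inter_iInter_translate_eq_empty_of_le Φ e hq k hk (by omega) hY hD

/-- **`(L^r · Y · D₀ ⋯ D_{k−1}) ≥ 1` iff EVERY iterated translate `⋂_j (D_j − τ_j)` meets `Y`** (the intersection
number is a natural number, `≠ 0` iff all translates meet `Y`). [cite: Fulton1998, §12.2 (a) and Example 12.2.1 (a)]
[cite: Lange2023AbelianVarietiesComplex, §4.6.2 Lemma 4.6.4 and Lemma 4.6.5] [cite: deJong1993AmpleLineBundles, Ch. VII §4 Thm. 4.3.1] -/
theorem IsRiemannForm.one_le_re_poincarePairing_wedgePow_smul_wedge_wedgeFamily_iff {q : ℕ}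
    (hq : 2 * q + 2 * 1 = n) (k : ℕ) {d p p' r : ℕ} (hk : 2 * d + 2 * p = n) (hp' : p + k = p') (hr : r + k = d)
    {Y : Set (ComplexTorus Φ)} (hY : HasPureDim 𝓘(ℂ, E) Y d)
    {D : Fin k → Set (ComplexTorus Φ)} (hD : ∀ j, HasPureDim 𝓘(ℂ, E) (D j) q)
    {η : E [⋀^Fin 2]→L[ℝ] ℝ} (hη : IsRiemannForm Φ η) :
    1 ≤ (poincarePairing Φ e (by omega : 2 * r + 2 * p' = n) (wedgePow (ofRealForm (-η)) r)
        ((orientationSign Φ e : ℂ) ^ k •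
          ((analyticCycleClass Φ e hk hY).wedge
              (wedgeFamily k fun j ↦ analyticCycleClass Φ e hq (hD j))).domDomCongr
            (finCongr (by omega : 2 * p + 2 * k = 2 * p')))).re ↔
      ∀ τ : Fin k → ComplexTorus Φ, (Y ∩ ⋂ j, (fun x ↦ x + τ j) ⁻¹' D j).Nonempty := by
  obtain ⟨m, hm⟩ := hη.exists_nat_poincarePairing_wedgePow_smul_wedge_wedgeFamily_eq Φ e hq k hk hp' hr hY hD
  have hzero := hη.poincarePairing_wedgePow_smul_wedge_wedgeFamily_eq_zero_iff_exists_inter_iInter_translate_eq_empty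
    Φ e hq k hk hp' hr hY hD
  rw [hm, Complex.natCast_re]
  rw [hm] at hzero
  constructor
  · intro h1 τ
    by_contra hne
    rw [not_nonempty_iff_eq_empty] at hne
    have h0 : (m : ℂ) = 0 := hzero.2 ⟨τ, hne⟩
    have : m = 0 := by exact_mod_cast h0
    rw [this, Nat.cast_zero] at h1
    exact absurd h1 (by norm_num)
  · intro hall
    have hm0 : m ≠ 0 := fun h ↦ by
      obtain ⟨τ, hτ⟩ := hzero.1 (by rw [h, Nat.cast_zero])
      exact (hall τ).ne_empty hτ
    exact_mod_cast Nat.one_le_iff_ne_zero.2 hm0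

/-! ### §3 Bézout with the integer `(L^r · Y · D₀ ⋯ D_{k−1})` -/

/-- **BÉZOUT, INTEGER FORM: there is `m = (L^r · Y · D₀ ⋯ D_{k−1}) ∈ ℕ` such that EVERY proper
`Y ∩ ⋂_j (D_j − τ_j)` has at most `m` irreducible components** (file 9 with the integrality of §1).
[cite: Fulton1998, §8.4 Prop. 8.4 and Example 8.4.6; §12.2 Example 12.2.1 (a)] [cite: deJong1993AmpleLineBundles, Ch. VII §4 Thm. 4.3.1] -/
theorem IsRiemannForm.exists_nat_poincarePairing_eq_and_forall_ncard_isIrreducibleComponent_le {q : ℕ}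
    (hq : 2 * q + 2 * 1 = n) (k : ℕ) {d p p' r : ℕ} (hk : 2 * d + 2 * p = n) (hp' : p + k = p') (hr : r + k = d)
    {Y : Set (ComplexTorus Φ)} (hY : HasPureDim 𝓘(ℂ, E) Y d)
    {D : Fin k → Set (ComplexTorus Φ)} (hD : ∀ j, HasPureDim 𝓘(ℂ, E) (D j) q)
    {η : E [⋀^Fin 2]→L[ℝ] ℝ} (hη : IsRiemannForm Φ η) :
    ∃ m : ℕ, poincarePairing Φ e (by omega : 2 * r + 2 * p' = n) (wedgePow (ofRealForm (-η)) r)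
        ((orientationSign Φ e : ℂ) ^ k •
          ((analyticCycleClass Φ e hk hY).wedge
              (wedgeFamily k fun j ↦ analyticCycleClass Φ e hq (hD j))).domDomCongr
            (finCongr (by omega : 2 * p + 2 * k = 2 * p'))) = m ∧
      ∀ τ : Fin k → ComplexTorus Φ,
        (Y ∩ ⋂ j, (fun x ↦ x + τ j) ⁻¹' D j = ∅ ∨ HasPureDim 𝓘(ℂ, E) (Y ∩ ⋂ j, (fun x ↦ x + τ j) ⁻¹' D j) r) →
          {C : Set (ComplexTorus Φ) |
            IsIrreducibleComponent 𝓘(ℂ, E) (Y ∩ ⋂ j, (fun x ↦ x + τ j) ⁻¹' D j) C}.ncard ≤ m := by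
  obtain ⟨m, hm⟩ := hη.exists_nat_poincarePairing_wedgePow_smul_wedge_wedgeFamily_eq Φ e hq k hk hp' hr hY hD
  exact ⟨m, hm, fun τ hZ ↦
    hη.ncard_isIrreducibleComponent_le_of_proper_of_poincarePairing_eq_natCast Φ e hq k hk hp' hr hY hD τ hZ hm⟩

end ComplexTorus

end Literature.Geometry.Kaehler

end
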